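import Mathlib
import Literature.NumberTheory.Transcendental.KZProductIdeal
import Literature.NumberTheory.Transcendental.KZCalculusOver
import Summits.KontsevichZagierPeriods.KontsevichZagierPeriods.Theorems.SoloInformedRealDiscTransfer
import HarnessLib

/-!
# The disc cylinder preserves the relations of `KZ_ℝ`: `[π] · relations ℝ ⊆ relations ℝ`

File of the solo-informed residency (s214).  In `SoloInformedRealDiscTransfer` the real-coefficient
calculus `KZ_ℝ` (`KZOver.IntegralRep ℝ`, `KZOver.relations ℝ`) received the one product it needs,
the **disc cylinder** `D̄ × [τ, g] = [D̄ × τ, 1 ⊗ g]`, as an additive map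
`soloInformedDiscMul : FormalRep ℝ →+ FormalRep ℝ`, and the open question `Q_ℝ` of the residency's
verdict was typed as `SoloInformedPiCancellationReal : ∀ c, discMul c ∈ relations ℝ → c ∈ relations ℝ`,
glossed "`[π]` is a non-zero-divisor on `FormalRep ℝ ⧸ relations ℝ`".  That gloss presupposes that
`discMul` DESCENDS to the quotient.  This file proves it:

* `soloInformed_discMul_mem_relations` — **`c ∈ relations ℝ → discMul c ∈ relations ℝ`**: each of
  the four moves with real-semialgebraic data is sent by `D̄ × ·` to a move of the same kind
  (`…_of_mem_domainAddRel / integrandAddRel / changeOfVariablesRel / newtonLeibnizRel`):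
  `D̄ × (σ₁ ∪ σ₂)` with `vol (D̄ × N) = π · 0 = 0`; `1 ⊗ (f₁ + f₂)`; the block change of variables
  `(y, x) ↦ (y, Φ x)` on `D̄ × σ` with `|det| = |det Φ'|` (`soloInformed_isSemialgebraicMapOn_discBlockMap`,
  no Tarski–Seidenberg); and a Newton–Leibniz band over `τ'` becomes a band over `D̄ × τ'` with
  primitive `1 ⊗ F`.  This is the `KZ_ℝ`-analogue, for the factor `[π]`, of the Literature theorem
  `KZ.of_mul_mem_relations` (`KZProductIdeal.lean`, coefficients `ℚ`), whose proof it follows.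
* `soloInformedDiscMulQuot : FormalRep ℝ ⧸ relations ℝ →+ FormalRep ℝ ⧸ relations ℝ` — multiplication
  by `[π]` on real formal periods `P_ℝ`, and **`soloInformed_piCancellationReal_iff_injective :
  SoloInformedPiCancellationReal ↔ Function.Injective soloInformedDiscMulQuot`** — so `Q_ℝ` as typed
  in the tree is literally the injectivity of `[π] ·` on `P_ℝ`.
* `soloInformed_equivalent_discCyl` — `r ∼ r'` over `ℝ` implies `D̄ × r ∼ D̄ × r'`;
  `soloInformed_eval_discMul` — `eval (discMul c) = π · eval c`;
  `soloInformed_map_discMul_relations_le` — the subgroup form.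

Nothing here decides `Q_ℝ`.  References: M. Kontsevich, D. Zagier, *Periods* (2001), §1.2 (the
moves), §4.1 (products); J. Cresson, J. Viu-Sos, JTNB 34 (2022), §1 (real semialgebraic data);
J. Bochnak, M. Coste, M.-F. Roy, *Real Algebraic Geometry* (1998), §2.2 (graphs and preimages).
-/

noncomputable section

open Set MeasureTheory MvPolynomial
open Literature.ModelTheory.ExponentialFields Literature.NumberTheory.Transcendental KZ

namespace Summit.KontsevichZagierPeriods.KontsevichZagierPeriods.Theorems

variable {n m d : ℕ}

/-! ### Semialgebraic bookkeeping on disc cylinders (no Tarski–Seidenberg) -/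

/-- A real-semialgebraic function of the trailing block, `z ↦ F (z|ᵐ)`, is `ℝ`-semialgebraic on the
disc cylinder `D̄ × τ` (its graph is a coordinate preimage of the graph of `F` cut down to the
cylinder). -/
theorem soloInformed_isSemialgebraicFunOn_discCyl_comp (s : KZOver.IntegralRep ℝ m)
    {F : (Fin m → ℝ) → ℝ} (hF : IsSemialgebraicFunOn ℝ s.domain F) :
    IsSemialgebraicFunOn ℝ (soloInformedDiscCylDomain s) (fun z => F fun j => z (Fin.natAdd 2 j)) := by
  rw [isSemialgebraicFunOn_iff]
  let ρ : Fin (m + 1) → Fin (2 + m + 1) :=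
    Fin.lastCases (Fin.last (2 + m)) fun j => Fin.castSucc (Fin.natAdd 2 j)
  have hΓ := (isSemialgebraicFunOn_iff.mp hF).preimage_comp ρ
  convert (soloInformed_isSemialgebraic_discCylDomain s).setOf_init_mem.inter hΓ using 1
  have hinit : ∀ w : Fin (2 + m + 1) → ℝ,
      Fin.init (w ∘ ρ) = fun j => Fin.init w (Fin.natAdd 2 j) := by
    intro w; ext j; simp [Fin.init, ρ]
  have hlast : ∀ w : Fin (2 + m + 1) → ℝ, (w ∘ ρ) (Fin.last m) = w (Fin.last (2 + m)) := by
    intro w; simp [ρ]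
  ext w
  simp only [mem_setOf_eq, mem_inter_iff, mem_preimage, hinit, hlast,
    soloInformed_mem_discCylDomain]
  tauto

/-- The block map `(y, x) ↦ (y, Φ x)` on the disc cylinder `D̄ × σ` is an `ℝ`-semialgebraic map when
`Φ` is `ℝ`-semialgebraic on `σ`: its graph is the intersection of a coordinate preimage of the graph
of `Φ`, a coordinate preimage of `D̄`, and the coordinate equalities `y' = y`. -/
theorem soloInformed_isSemialgebraicMapOn_discBlockMap (s : KZOver.IntegralRep ℝ n)
    {Φ : (Fin n → ℝ) → (Fin n → ℝ)} (hΦ : IsSemialgebraicMapOn ℝ s.domain Φ) :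
    IsSemialgebraicMapOn ℝ (soloInformedDiscCylDomain s)
      (fun z => Fin.append (fun i => z (Fin.castAdd n i)) (Φ fun j => z (Fin.natAdd 2 j))) := by
  rw [isSemialgebraicMapOn_iff]
  have hG := isSemialgebraicMapOn_iff.mp hΦ
  have hA : IsSemialgebraic ℝ piDisc := isSemialgebraic_piDisc.baseChange ℝ
  let ρ : Fin (n + n) → Fin (2 + n + (2 + n)) :=
    Fin.append (fun j => Fin.castAdd (2 + n) (Fin.natAdd 2 j))
      (fun j => Fin.natAdd (2 + n) (Fin.natAdd 2 j))
  have h1 := hG.preimage_comp ρ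
  have h2 := hA.preimage_comp (fun i : Fin 2 => Fin.castAdd (2 + n) (Fin.castAdd n i))
  have h3 : IsSemialgebraic ℝ (⋂ i ∈ (Finset.univ : Finset (Fin 2)),
      {w : Fin (2 + n + (2 + n)) → ℝ |
        w (Fin.natAdd (2 + n) (Fin.castAdd n i)) = w (Fin.castAdd (2 + n) (Fin.castAdd n i))}) := by
    refine IsSemialgebraic.biInter Finset.univ _ fun i _ => ?_
    convert isSemialgebraic_setOf_eval_eq_zero (k := ℝ) (R := ℝ)
      (X (Fin.natAdd (2 + n) (Fin.castAdd n i)) -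
        X (Fin.castAdd (2 + n) (Fin.castAdd n i)) : MvPolynomial (Fin (2 + n + (2 + n))) ℝ) using 1
    ext w
    simp [sub_eq_zero]
  have hρa : ∀ (w : Fin (2 + n + (2 + n)) → ℝ) (i : Fin n),
      (w ∘ ρ) (Fin.castAdd n i) = w (Fin.castAdd (2 + n) (Fin.natAdd 2 i)) := by
    intro w i
    simp only [Function.comp_apply, ρ, Fin.append_left]
  have hρb : ∀ (w : Fin (2 + n + (2 + n)) → ℝ) (j : Fin n),
      (w ∘ ρ) (Fin.natAdd n j) = w (Fin.natAdd (2 + n) (Fin.natAdd 2 j)) := by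
    intro w j
    simp only [Function.comp_apply, ρ, Fin.append_right]
  convert h2.inter (h1.inter h3) using 1
  ext w
  simp only [mem_setOf_eq, mem_inter_iff, mem_preimage, mem_iInter, Finset.mem_univ, true_imp_iff,
    KZ.eq_append_iff, soloInformed_mem_discCylDomain]
  simp only [hρa, hρb]
  simp only [Function.comp_def, funext_iff]
  tauto

/-! ### The four moves under `D̄ × ·` -/

/-- **`D̄ × (domain additivity)` is a domain-additivity move**:
`D̄ × (σ₁ ∪ σ₂) = (D̄ × σ₁) ∪ (D̄ × σ₂)` with `vol ((D̄ × σ₁) ∩ (D̄ × σ₂)) = vol D̄ · vol (σ₁ ∩ σ₂) = 0`,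
and `1 ⊗ f = 1 ⊗ fᵢ` on `D̄ × σᵢ`. -/
theorem soloInformed_discMul_mem_relations_of_mem_domainAddRel {c : KZOver.FormalRep ℝ}
    (hc : c ∈ KZOver.domainAddRel ℝ) : soloInformedDiscMul c ∈ KZOver.relations ℝ := by
  obtain ⟨n, r, r₁, r₂, hdom, hnull, h₁, h₂, rfl⟩ := hc
  rw [map_sub, map_sub, soloInformed_discMul_of, soloInformed_discMul_of, soloInformed_discMul_of]
  refine KZOver.domainAddRel_subset_relations
    ⟨2 + n, soloInformedDiscCyl r, soloInformedDiscCyl r₁, soloInformedDiscCyl r₂, ?_, ?_, ?_, ?_, rfl⟩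
  · ext z
    simp only [soloInformed_discCyl_domain, soloInformed_mem_discCylDomain, hdom, mem_union]
    tauto
  · have hsub : (soloInformedDiscCyl r₁).domain ∩ (soloInformedDiscCyl r₂).domain =
        {z : Fin (2 + n) → ℝ | (fun i => z (Fin.castAdd n i)) ∈ piDisc ∧
          (fun j => z (Fin.natAdd 2 j)) ∈ r₁.domain ∩ r₂.domain} := by
      ext z
      simp only [soloInformed_discCyl_domain, mem_inter_iff, soloInformed_mem_discCylDomain,
        mem_setOf_eq]
      tauto
    rw [hsub, KZ.volume_cylinder, hnull, mul_zero]
  · intro z hz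
    rw [soloInformed_discCyl_integrand, soloInformed_discCyl_integrand,
      soloInformed_discCylFun_apply, soloInformed_discCylFun_apply, h₁ hz.2]
  · intro z hz
    rw [soloInformed_discCyl_integrand, soloInformed_discCyl_integrand,
      soloInformed_discCylFun_apply, soloInformed_discCylFun_apply, h₂ hz.2]

/-- **`D̄ × (integrand additivity)` is an integrand-additivity move**:
`1 ⊗ (f₁ + f₂) = 1 ⊗ f₁ + 1 ⊗ f₂` on `D̄ × σ`. -/
theorem soloInformed_discMul_mem_relations_of_mem_integrandAddRel {c : KZOver.FormalRep ℝ}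
    (hc : c ∈ KZOver.integrandAddRel ℝ) : soloInformedDiscMul c ∈ KZOver.relations ℝ := by
  obtain ⟨n, r, r₁, r₂, h₁, h₂, hadd, rfl⟩ := hc
  rw [map_sub, map_sub, soloInformed_discMul_of, soloInformed_discMul_of, soloInformed_discMul_of]
  refine KZOver.integrandAddRel_subset_relations
    ⟨2 + n, soloInformedDiscCyl r, soloInformedDiscCyl r₁, soloInformedDiscCyl r₂, ?_, ?_, ?_, rfl⟩
  · ext z
    simp only [soloInformed_discCyl_domain, soloInformed_mem_discCylDomain, h₁]
  · ext z
    simp only [soloInformed_discCyl_domain, soloInformed_mem_discCylDomain, h₂]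
  · intro z hz
    rw [soloInformed_discCyl_integrand, soloInformed_discCyl_integrand, soloInformed_discCyl_integrand,
      Pi.add_apply, soloInformed_discCylFun_apply, soloInformed_discCylFun_apply,
      soloInformed_discCylFun_apply, hadd hz.2, Pi.add_apply]

/-- **`D̄ × (Newton–Leibniz)` is a Newton–Leibniz move.** If `[r] − [r']` is rule (3) along the last
coordinate over the base `τ'` with bounds `a ≤ b` and primitive `F`, then
`D̄ × band = {(y, x, s) | (y, x) ∈ D̄ × τ', a x ≤ s ≤ b x}` is again a band in the last coordinate
(`Fin (2 + (n + 1)) = Fin ((2 + n) + 1)` definitionally) over the base `D̄ × τ'`, with bounds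
`a ∘ pr₂ ≤ b ∘ pr₂` and primitive `(y, x, s) ↦ F (x, s)`; continuity on the closed fibres, the
derivative on the open fibres and the boundary formula are inherited verbatim. -/
theorem soloInformed_discMul_mem_relations_of_mem_newtonLeibnizRel {c : KZOver.FormalRep ℝ}
    (hc : c ∈ KZOver.newtonLeibnizRel ℝ) : soloInformedDiscMul c ∈ KZOver.relations ℝ := by
  obtain ⟨n, r, r', a, b, F, hF, ha, hb, hab, hdom, hcont, hderiv, hr', rfl⟩ := hc
  rw [map_sub, soloInformed_discMul_of, soloInformed_discMul_of]
  refine KZOver.newtonLeibnizRel_subset_relations ⟨2 + n, soloInformedDiscCyl r, soloInformedDiscCyl r',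
    fun z => a (fun j => z (Fin.natAdd 2 j)), fun z => b (fun j => z (Fin.natAdd 2 j)),
    fun w => F (fun j => w (Fin.natAdd 2 j)),
    ?_, ?_, ?_, ?_, ?_, ?_, ?_, ?_, rfl⟩
  · exact soloInformed_isSemialgebraicFunOn_discCyl_comp r hF
  · exact soloInformed_isSemialgebraicFunOn_discCyl_comp r' ha
  · exact soloInformed_isSemialgebraicFunOn_discCyl_comp r' hb
  · intro z hz
    exact hab _ hz.2
  · ext w
    change ((fun i => w (Fin.castAdd (n + 1) i)) ∈ piDisc ∧
        (fun j => w (Fin.natAdd 2 j)) ∈ r.domain) ↔ _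
    rw [hdom]
    simp only [soloInformed_discCyl_domain, soloInformed_mem_discCylDomain, mem_setOf_eq,
      KZ.init_castAdd, KZ.init_natAdd, KZ.apply_natAdd_last]
    tauto
  · intro z hz
    simp only [KZ.snoc_natAdd]
    exact hcont _ hz.2
  · intro z hz s hs
    simp only [KZ.snoc_natAdd, soloInformed_discCyl_integrand, soloInformed_discCylFun_apply]
    exact hderiv _ hz.2 s hs
  · intro z hz
    simp only [soloInformed_discCyl_integrand, soloInformed_discCylFun_apply, KZ.snoc_natAdd]
    exact hr' _ hz.2

/-- **`D̄ × (change of variables)` is a change-of-variables move**: for `Φ` on `σ` as in rule (2),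
the block map `Ψ (y, x) = (y, Φ x)` on `D̄ × σ` is `ℝ`-semialgebraic
(`soloInformed_isSemialgebraicMapOn_discBlockMap`), injective, has derivative `id × Φ' x` within
`D̄ × σ` (chain rule through `ℝ² × ℝⁿ ≃ ℝ²⁺ⁿ`, `HasFDerivWithinAt.prodMap`), image `D̄ × Φ '' σ`, and
`|det (id × Φ' x)| = |det Φ' x|` (`LinearMap.det_conj`, `LinearMap.det_prodMap`), so
`1 ⊗ f = (1 ⊗ f') ∘ Ψ · |det Ψ'|` on `D̄ × σ`. -/
theorem soloInformed_discMul_mem_relations_of_mem_changeOfVariablesRel {c : KZOver.FormalRep ℝ}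
    (hc : c ∈ KZOver.changeOfVariablesRel ℝ) : soloInformedDiscMul c ∈ KZOver.relations ℝ := by
  obtain ⟨n, r, r', Φ, Φ', hΦ, hΦ', hinj, hdom, hf, rfl⟩ := hc
  rw [map_sub, soloInformed_discMul_of, soloInformed_discMul_of]
  -- the linear identification `ℝ² × ℝⁿ ≃ ℝ²⁺ⁿ`
  let e : ((Fin 2 → ℝ) × (Fin n → ℝ)) ≃ₗ[ℝ] (Fin (2 + n) → ℝ) :=
    { toFun := fun p => Fin.append p.1 p.2
      invFun := fun z => (fun i => z (Fin.castAdd n i), fun j => z (Fin.natAdd 2 j))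
      map_add' := fun p q => by
        ext i; refine Fin.addCases (fun i => ?_) (fun j => ?_) i <;> simp
      map_smul' := fun c p => by
        ext i; refine Fin.addCases (fun i => ?_) (fun j => ?_) i <;> simp
      left_inv := fun p => by ext <;> simp
      right_inv := fun z => by
        ext i; refine Fin.addCases (fun i => ?_) (fun j => ?_) i <;> simp }
  let eL : ((Fin 2 → ℝ) × (Fin n → ℝ)) ≃L[ℝ] (Fin (2 + n) → ℝ) := e.toContinuousLinearEquiv
  have heL : ∀ p, eL p = Fin.append p.1 p.2 := fun p => rfl
  have heL_symm : ∀ z, eL.symm z = (fun i => z (Fin.castAdd n i), fun j => z (Fin.natAdd 2 j)) :=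
    fun z => rfl
  -- the block map and its derivative
  let Ψ : (Fin (2 + n) → ℝ) → (Fin (2 + n) → ℝ) := eL ∘ Prod.map id Φ ∘ eL.symm
  let Ψ' : (Fin (2 + n) → ℝ) → (Fin (2 + n) → ℝ) →L[ℝ] (Fin (2 + n) → ℝ) := fun z =>
    (eL : _ →L[ℝ] _).comp ((((ContinuousLinearMap.id ℝ (Fin 2 → ℝ)).prodMap
      (Φ' (fun j => z (Fin.natAdd 2 j)))).comp (eL.symm : _ →L[ℝ] _)))
  have hΨ : ∀ z, Ψ z = Fin.append (fun i => z (Fin.castAdd n i)) (Φ fun j => z (Fin.natAdd 2 j)) :=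
    fun z => rfl
  have hdet : ∀ z, (Ψ' z).det = (Φ' (fun j => z (Fin.natAdd 2 j))).det := by
    intro z
    have hcoe : ((Ψ' z : (Fin (2 + n) → ℝ) →L[ℝ] (Fin (2 + n) → ℝ)) :
        (Fin (2 + n) → ℝ) →ₗ[ℝ] (Fin (2 + n) → ℝ)) =
      (e : ((Fin 2 → ℝ) × (Fin n → ℝ)) →ₗ[ℝ] (Fin (2 + n) → ℝ)) ∘ₗ
        (((LinearMap.id : (Fin 2 → ℝ) →ₗ[ℝ] (Fin 2 → ℝ)).prodMap
          ((Φ' (fun j => z (Fin.natAdd 2 j)) : (Fin n → ℝ) →L[ℝ] (Fin n → ℝ)) :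
            (Fin n → ℝ) →ₗ[ℝ] (Fin n → ℝ))) ∘ₗ
        (e.symm : (Fin (2 + n) → ℝ) →ₗ[ℝ] ((Fin 2 → ℝ) × (Fin n → ℝ)))) :=
      LinearMap.ext fun v => rfl
    change LinearMap.det _ = LinearMap.det _
    rw [hcoe, LinearMap.det_conj, LinearMap.det_prodMap, LinearMap.det_id, one_mul]
  have hS : (soloInformedDiscCyl r).domain = eL.symm ⁻¹' (piDisc ×ˢ r.domain) := rfl
  refine KZOver.changeOfVariablesRel_subset_relations
    ⟨2 + n, soloInformedDiscCyl r, soloInformedDiscCyl r', Ψ, Ψ', ?_, ?_, ?_, ?_, ?_, rfl⟩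
  · exact (soloInformed_isSemialgebraicMapOn_discBlockMap r hΦ).congr fun z _ => (hΨ z).symm
  · intro z hz
    have hx : (fun j => z (Fin.natAdd 2 j)) ∈ r.domain := hz.2
    have hg : HasFDerivWithinAt (Prod.map id Φ)
        ((ContinuousLinearMap.id ℝ (Fin 2 → ℝ)).prodMap (Φ' (fun j => z (Fin.natAdd 2 j))))
        (piDisc ×ˢ r.domain) (eL.symm z) := by
      refine HasFDerivWithinAt.prodMap (eL.symm z) (hasFDerivWithinAt_id _ _) ((hΦ' _ hx).mono ?_)
      rintro _ ⟨q, hq, rfl⟩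
      exact hq.2
    have h2 := (eL.comp_hasFDerivWithinAt_iff).mpr hg
    have h3 := (eL.symm.comp_right_hasFDerivWithinAt_iff (f := eL ∘ Prod.map id Φ)).mpr h2
    rw [hS]
    exact h3
  · intro z₁ hz₁ z₂ hz₂ h
    rw [hΨ, hΨ] at h
    have h' := congrArg (fun w : Fin (2 + n) → ℝ =>
      ((fun i => w (Fin.castAdd n i)), (fun j => w (Fin.natAdd 2 j)))) h
    simp only [Fin.append_left, Fin.append_right, Prod.mk.injEq] at h'
    have h2 : (fun j => z₁ (Fin.natAdd 2 j)) = fun j => z₂ (Fin.natAdd 2 j) := hinj hz₁.2 hz₂.2 h'.2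
    rw [← Fin.append_castAdd_natAdd (f := z₁), ← Fin.append_castAdd_natAdd (f := z₂), h'.1, h2]
  · ext w
    simp only [soloInformed_discCyl_domain, soloInformed_mem_discCylDomain, hdom, mem_image]
    constructor
    · rintro ⟨hw₁, x, hx, hwx⟩
      refine ⟨Fin.append (fun i => w (Fin.castAdd n i)) x,
        ⟨by simpa using hw₁, by simpa using hx⟩, ?_⟩
      rw [hΨ]
      simp only [Fin.append_left, Fin.append_right]
      conv_rhs => rw [← Fin.append_castAdd_natAdd (f := w)]
      simp [hwx]
    · rintro ⟨z, hz, rfl⟩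
      rw [hΨ]
      simp only [Fin.append_left, Fin.append_right]
      exact ⟨by simpa using hz.1, _, hz.2, rfl⟩
  · intro z hz
    rw [soloInformed_discCyl_integrand, soloInformed_discCyl_integrand,
      soloInformed_discCylFun_apply, soloInformed_discCylFun_apply, hf _ hz.2, hdet, hΨ]
    simp only [Fin.append_right]

/-! ### Assembly: `discMul` preserves `relations ℝ` -/

/-- **`D̄ × relations ℝ ⊆ relations ℝ`.** Multiplication by the disc preserves the relations of the
real-coefficient calculus `KZ_ℝ`: by `AddSubgroup.closure_induction`, each generator being sent to a
move of the same kind and `discMul` being additive. -/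
theorem soloInformed_discMul_mem_relations {c : KZOver.FormalRep ℝ} (hc : c ∈ KZOver.relations ℝ) :
    soloInformedDiscMul c ∈ KZOver.relations ℝ := by
  refine AddSubgroup.closure_induction (fun x hx => ?_) ?_ (fun x y _ _ hx hy => ?_)
    (fun x _ hx => ?_) hc
  · rcases hx with ((hx | hx) | hx) | hx
    · exact soloInformed_discMul_mem_relations_of_mem_domainAddRel hx
    · exact soloInformed_discMul_mem_relations_of_mem_integrandAddRel hx
    · exact soloInformed_discMul_mem_relations_of_mem_changeOfVariablesRel hx
    · exact soloInformed_discMul_mem_relations_of_mem_newtonLeibnizRel hx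
  · rw [map_zero]; exact (KZOver.relations ℝ).zero_mem
  · rw [map_add]; exact (KZOver.relations ℝ).add_mem hx hy
  · rw [map_neg]; exact (KZOver.relations ℝ).neg_mem hx

/-- Subgroup form: `discMul` maps `relations ℝ` into `relations ℝ`. -/
theorem soloInformed_map_discMul_relations_le :
    (KZOver.relations ℝ).map soloInformedDiscMul ≤ KZOver.relations ℝ := by
  rintro _ ⟨c, hc, rfl⟩
  exact soloInformed_discMul_mem_relations hc

/-- **Equivalent representations have equivalent disc cylinders**: `r ∼ r'` over `ℝ` implies
`D̄ × r ∼ D̄ × r'` over `ℝ`. -/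
theorem soloInformed_equivalent_discCyl {r : KZOver.IntegralRep ℝ n} {r' : KZOver.IntegralRep ℝ m}
    (h : KZOver.Equivalent r r') :
    KZOver.Equivalent (soloInformedDiscCyl r) (soloInformedDiscCyl r') := by
  have h' := soloInformed_discMul_mem_relations h
  rw [map_sub, soloInformed_discMul_of, soloInformed_discMul_of] at h'
  exact h'

/-- **`eval (discMul c) = π · eval c`** on formal combinations (Fubini on generators,
`soloInformed_value_discCyl`, and additivity). -/
theorem soloInformed_eval_discMul (c : KZOver.FormalRep ℝ) :
    KZOver.eval ℝ (soloInformedDiscMul c) = Real.pi * KZOver.eval ℝ c := by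
  induction c using FreeAbelianGroup.induction_on with
  | zero => simp
  | of x =>
    obtain ⟨m, s⟩ := x
    show KZOver.eval ℝ (soloInformedDiscMul (KZOver.of s)) = Real.pi * KZOver.eval ℝ (KZOver.of s)
    rw [soloInformed_discMul_of, KZOver.eval_of, KZOver.eval_of, soloInformed_value_discCyl]
  | neg x ih => simp only [map_neg, ih, mul_neg]
  | add x y hx hy => simp only [map_add, hx, hy, mul_add]

/-! ### `[π] ·` on real formal periods and `Q_ℝ` as injectivity -/

/-- **Multiplication by `[π]` on real formal periods** `P_ℝ = FormalRep ℝ ⧸ relations ℝ`: the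
endomorphism induced by the disc cylinder (well defined by `soloInformed_discMul_mem_relations`). -/
def soloInformedDiscMulQuot :
    KZOver.FormalRep ℝ ⧸ KZOver.relations ℝ →+ KZOver.FormalRep ℝ ⧸ KZOver.relations ℝ :=
  QuotientAddGroup.map (KZOver.relations ℝ) (KZOver.relations ℝ) soloInformedDiscMul
    fun _ hc => soloInformed_discMul_mem_relations hc

/-- `discMulQuot` on the class of `c` is the class of `discMul c`. -/
@[simp] theorem soloInformed_discMulQuot_mk (c : KZOver.FormalRep ℝ) :
    soloInformedDiscMulQuot (c : KZOver.FormalRep ℝ ⧸ KZOver.relations ℝ) =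
      ((soloInformedDiscMul c : KZOver.FormalRep ℝ) : KZOver.FormalRep ℝ ⧸ KZOver.relations ℝ) :=
  rfl

/-- **`Q_ℝ` is the injectivity of `[π] ·` on `P_ℝ`.** The tree's statement
`SoloInformedPiCancellationReal` (`∀ c, discMul c ∈ relations ℝ → c ∈ relations ℝ`) holds iff the
endomorphism `soloInformedDiscMulQuot` of `FormalRep ℝ ⧸ relations ℝ` is injective, i.e. iff `[π]` is
a non-zero-divisor on real formal periods.  Nothing is asserted about either side (OPEN). -/
theorem soloInformed_piCancellationReal_iff_injective :
    SoloInformedPiCancellationReal ↔ Function.Injective soloInformedDiscMulQuot := by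
  rw [injective_iff_map_eq_zero]
  constructor
  · intro h x hx
    induction x using QuotientAddGroup.induction_on with
    | H c =>
      rw [soloInformed_discMulQuot_mk, QuotientAddGroup.eq_zero_iff] at hx
      exact (QuotientAddGroup.eq_zero_iff c).mpr (h c hx)
  · intro h c hc
    have := h (c : KZOver.FormalRep ℝ ⧸ KZOver.relations ℝ)
      (by rw [soloInformed_discMulQuot_mk, QuotientAddGroup.eq_zero_iff]; exact hc)
    exact (QuotientAddGroup.eq_zero_iff c).mp this

/-- **Iterates**: `[π]^N ·` preserves `relations ℝ`. -/
theorem soloInformed_discMul_iterate_mem_relations (N : ℕ) {c : KZOver.FormalRep ℝ}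
    (hc : c ∈ KZOver.relations ℝ) : soloInformedDiscMul^[N] c ∈ KZOver.relations ℝ := by
  induction N generalizing c with
  | zero => simpa using hc
  | succ N ih =>
    rw [Function.iterate_succ_apply]
    exact ih (soloInformed_discMul_mem_relations hc)

/-- **`Q_ℝ` cancels every power of `[π]`**: under `SoloInformedPiCancellationReal`,
`[π]^N · c ∈ relations ℝ → c ∈ relations ℝ`. -/
theorem soloInformed_piCancellationReal_iterate (h : SoloInformedPiCancellationReal) (N : ℕ)
    {c : KZOver.FormalRep ℝ} (hc : soloInformedDiscMul^[N] c ∈ KZOver.relations ℝ) :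
    c ∈ KZOver.relations ℝ := by
  induction N generalizing c with
  | zero => simpa using hc
  | succ N ih =>
    rw [Function.iterate_succ_apply] at hc
    exact h c (ih hc)

end Summit.KontsevichZagierPeriods.KontsevichZagierPeriods.Theorems
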